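import Summits.QuantumFields.BalabanUV.Beta.EriceRemainderEnclosureHistoryAutonomyComparisonNonlinearRowPrep

/-!
# EriceRemainderEnclosureHistoryAutonomyComparisonNonlinearRowDefect — (E121c) THE NONLINEAR ROW INEQUALITY OF THE COMPARISON COLUMN WITH THE PER-AGE DAMPING DEFECT AS A
# HYPOTHESIS (the refactoring asked for in `HOME/b2b-balaban-beta-d4-p2/g98/README.md` §4, so that no further copy of (E118b) is needed).  Base memory AFFINE,
# `B u = β₀ + Σ_{k<K} L_k·u_k` (`β₀ > 0`, `L ≥ 0`, `L_0 = 0`), perturbation `B′` isotone with floor and modulus (nothing else about `B′ − B` is assumed here); solution families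
# `S`, `S′`; base orbit `h = S y`; configuration `n` = (`h(n+·)`, `S′(h_n)`); `X_n = B′(S′h_n) − B(S h_n)`, `e_n = (B′ − B)(S′h_n)`, `c_{n,k} = L_kh_{n+k}³∕2`, `F(n) = Σ_{1≤k<K} c_{n,k}`,
# `δ^{(n+1)}_j = 1∕S′(h_{n+1})_j² − 1∕h_{n+1+j}²`.  THEN (**`row_ge_of_defect`**): whenever the configurations compare from every pin `h_m`, `m ≥ n`, and THE DAMPING DEFECT OF
# CONFIGURATION `n+1` IS CONTROLLED AGE BY AGE, `δ^{(n+1)}_{k−1} − δ^{(n+1)}_k ≤ θ_k·δ^{(n+1)}_{k−1}` (`θ_k ≥ 0` a hypothesis),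
#
#   `X_n ≥ (e_n − e_{n+1}) + (1 − F(n))·X_{n+1} − Σ_{1≤k<K} (c_{n,k} − c_{n+1,k} + c_{n+1,k}·θ_k)·δ^{(n+1)}_{k−1}`.
#
# This is (E118b) `row_ge` with (E118a) `conf_incr_ge` (`θ_k = F(n+k+1) + ME·h_{n+k+1}³∕2`) taken out as a hypothesis; (E120a) `row_ge_light` is the instance `θ_k = F(n+k+1)`
# and the sequel (E121d∕e) plugs in (E121a) `conf_incr_ge_var` (`θ_k = F(n+k+1) + e_{n+k+1}·h_{n+k+1}²`, steep excesses of small size).  PROOF = (E118b)'s, verbatim otherwise: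
# `step_eq_drop`, the SANDWICH `conf_sandwich` + `conf_first_le_step` for the first entries, per age the HEATING `heating_le` and the defect hypothesis at the point below
# `h_{n+1+k}` at the same level gap.

Cell `pub-balaban`, β-function sub-cell, BINDER row D4 «RemainderConst leaves for Bałaban's split» (`HOME/BINDER-OWNERS.md`; owner lineage `b2b-balaban-beta-an4`;
this file by co-owner #2 lineage `b2b-balaban-beta-d4-p2`, generation 99), β-FLOW TEAM duty (1), FREEZE (0) honoured (def-free; imports (E118a) `…NonlinearRowPrep`
and uses its lemmas, (E48a) `family_mem` ∕ `family_zero` ∕ `strictAnti_of_memFlow`, node U2's `Sharpness.abs_sub_le_half_cube_mul` BY NAME; the proof is (E118b)'s re-run —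
nothing else restated).

HONEST FRAMING (page 1, verbatim and binding).  *"Discharging BetaPertH makes Bałaban's UV stability UNCONDITIONAL — a real constructive-QFT result; it is
NOT the continuum limit and NOT the Clay problem."*  THIS FILE DISCHARGES NOTHING OF THE KIND.  Elementary real analysis about ABSTRACT functionals on a box
]0,γ]^ℕ with displayed floors, moduli, profiles and signs — hypotheses of a census, not facts; the form, signs, ages and moments of Bałaban's (1.22) limit
functional are NOT PRINTED ([I] p. 298; GAPS G-t4-U2-1∕-2) and NOT asserted.  Row D4 class UNCHANGED (critical-path width 0; instance 0∕1; D4 DISCHARGE NO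
DATE).  HONEST DEPENDENCY: continuum YM on T⁴ ⇐ BetaPertH ∧ nine spine estimates (0/9 proved); BetaPertH ⇐ (D1) ∧ (D4) ∧ CAP+tail; G-an2-4 gates asym, D1
and NE2/3/4.  NOT CLAIMED here: any comparison theorem (that is the sequel); anything printed — NOT B12 Thm 2, NOT BetaPertH, NOT continuum, NOT Clay.

WHAT IS PROVED ([folklore]; 0 `def`, 0 sorry).  **`row_ge_of_defect`**.
-/

noncomputable section
open Finset Set

namespace Summit.QuantumFields.BalabanUV.Beta.EriceRemainderEnclosureHistoryAutonomyComparisonNonlinearRowDefect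

open Literature.MathematicalPhysics.QuantumFieldTheory.Balaban1983to89
open Literature.MathematicalPhysics.QuantumFieldTheory.Balaban1983to89.T4BetaStationary
open Literature.MathematicalPhysics.QuantumFieldTheory.Balaban1983to89.T4BetaFlowWellPosed
open Literature.MathematicalPhysics.QuantumFieldTheory.Balaban1983to89.T4BetaFlowWellPosed.Sharpness (abs_sub_le_half_cube_mul)
open Summit.QuantumFields.BalabanUV.Beta.EriceRemainderEnclosureHistoryAutonomyOrder (family_mem family_zero strictAnti_of_memFlow)
open Summit.QuantumFields.BalabanUV.Beta.EriceRemainderEnclosureHistoryAutonomyComparisonNonlinearRowPrep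

variable {B B' : (ℕ → ℝ) → ℝ} {γ β₀ b' M' : ℝ} {L : ℕ → ℝ} {K : ℕ} {S S' : ℝ → ℕ → ℝ}

/-! ## §4′ The nonlinear row inequality, defect as a hypothesis -/

set_option maxHeartbeats 800000 in
/-- **THE NONLINEAR ROW INEQUALITY WITH THE DAMPING DEFECT AS A HYPOTHESIS.**  `B u = β₀ + Σ_{k<K} L_k·u_k` (`β₀ > 0`, `L ≥ 0`, `L_0 = 0`); `B′` isotone with floor,
modulus, unique solutions; solution families `S`, `S′`; base orbit `h = S y`.  If the configurations compare from every pin `h_m`, `m ≥ n`, and configuration `n+1`'s level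
gaps satisfy `δ^{(n+1)}_{k−1} − δ^{(n+1)}_k ≤ θ_k·δ^{(n+1)}_{k−1}` for the ages `1 ≤ k < K` (`θ ≥ 0` GIVEN), then (notation of (E118b))
`(e_n − e_{n+1}) + (1 − F(n))·X_{n+1} − Σ_{1≤k<K} (c_{n,k} − c_{n+1,k} + c_{n+1,k}·θ_k)·δ^{(n+1)}_{k−1} ≤ X_n` — (E118b) `row_ge`'s proof verbatim with (E118a) `conf_incr_ge`
replaced by the hypothesis; instances: `θ_k = F(n+k+1) + ME·h³∕2` ((E118a)), `F(n+k+1)` below light rows ((E120a)), `F(n+k+1) + e·h²` ((E121a) `conf_incr_ge_var`). [folklore] -/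
theorem row_ge_of_defect (hBaff : ∀ u, SeqBox γ u → B u = β₀ + ∑ k ∈ range K, L k * u k) (hL : ∀ k, 0 ≤ L k) (hβ : 0 < β₀)
    (hmono' : ∀ u v : ℕ → ℝ, SeqBox γ u → SeqBox γ v → (∀ j, u j ≤ v j) → B' u ≤ B' v) (hb' : 0 < b')
    (hB' : ∀ u u' : ℕ → ℝ, SeqBox γ u → SeqBox γ u' → ∀ D : ℝ, (∀ j, |u j - u' j| ≤ D) → |B' u - B' u'| ≤ M' * D) (hM' : 0 ≤ M')
    (hlo' : ∀ u, SeqBox γ u → b' ≤ B' u)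
    (hS : ∀ p, 0 < p → p ≤ γ → SeqBox γ (S p) ∧ MemFlow B p (S p))
    (huniq : ∀ p, 0 < p → p ≤ γ → ∀ u u' : ℕ → ℝ, SeqBox γ u → SeqBox γ u' → MemFlow B p u → MemFlow B p u' → u = u')
    (hS' : ∀ p, 0 < p → p ≤ γ → SeqBox γ (S' p) ∧ MemFlow B' p (S' p))
    (huniq' : ∀ p, 0 < p → p ≤ γ → ∀ u u' : ℕ → ℝ, SeqBox γ u → SeqBox γ u' → MemFlow B' p u → MemFlow B' p u' → u = u')
    {y : ℝ} (hy : 0 < y) (hyγ : y ≤ γ) (n : ℕ)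
    (hcmp : ∀ m, n ≤ m → ∀ j, S' (S y m) j ≤ S y (m + j)) {θ : ℕ → ℝ} (hθ0 : ∀ k, 0 ≤ θ k)
    (hdef : ∀ j, j + 1 < K → (1 / S' (S y (n + 1)) j ^ 2 - 1 / S y (n + 1 + j) ^ 2) - (1 / S' (S y (n + 1)) (j + 1) ^ 2 - 1 / S y (n + 1 + j + 1) ^ 2)
      ≤ θ (j + 1) * (1 / S' (S y (n + 1)) j ^ 2 - 1 / S y (n + 1 + j) ^ 2)) :
    ((B' (S' (S y n)) - B (S' (S y n))) - (B' (S' (S y (n + 1))) - B (S' (S y (n + 1)))))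
      + (1 - ∑ k ∈ Ico 1 K, L k * S y (n + k) ^ 3 / 2) * (B' (S' (S y (n + 1))) - B (S (S y (n + 1))))
      - ∑ k ∈ Ico 1 K, (L k * S y (n + k) ^ 3 / 2 - L k * S y (n + 1 + k) ^ 3 / 2
            + L k * S y (n + 1 + k) ^ 3 / 2 * θ k)
          * (1 / S' (S y (n + 1)) (k - 1) ^ 2 - 1 / S y (n + k) ^ 2)
      ≤ B' (S' (S y n)) - B (S (S y n)) := by
  obtain ⟨_, hloB, _, _⟩ := affine_facts hBaff hL hβ
  have hh := (hS y hy hyγ).1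
  have hf := (hS y hy hyγ).2
  have hpos : ∀ j, 0 < S y j := fun j => (hh j).1
  have hanti := (strictAnti_of_memFlow hβ hloB hh hf).antitone
  have hqn := family_mem hS hy hyγ n
  have hq1 := family_mem hS hy hyγ (n + 1)
  have hw := hS' _ hqn.1 hqn.2          -- configuration n
  have hk := hS' _ hq1.1 hq1.2          -- configuration n+1
  have hwpos : ∀ j, 0 < S' (S y n) j := fun j => (hw.1 j).1
  have hkpos : ∀ j, 0 < S' (S y (n + 1)) j := fun j => (hk.1 j).1
  have hwle : ∀ j, S' (S y n) j ≤ S y (n + j) := hcmp n le_rfl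
  have hkle : ∀ j, S' (S y (n + 1)) j ≤ S y (n + 1 + j) := hcmp (n + 1) (by omega)
  -- the two step quantities as excess minus drop, drops summed over the ages 1 ≤ k < K
  have hXn := step_eq_drop hBaff hS huniq hS' hy hyγ n
  have hXn1 := step_eq_drop hBaff hS huniq hS' hy hyγ (n + 1)
  rw [sum_range_eq_Ico_of_zero (f := fun k => L k * (S y (n + k) - S' (S y n) k)) (by simp [family_zero hS' hqn.1 hqn.2])] at hXn
  rw [sum_range_eq_Ico_of_zero (f := fun k => L k * (S y (n + 1 + k) - S' (S y (n + 1)) k)) (by simp [family_zero hS' hq1.1 hq1.2])] at hXn1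
  -- the first increment of configuration n
  obtain ⟨hd0, hdX⟩ := conf_first_le_step hmono' hb' hB' hM' hlo' hS huniq hS' huniq' hy hyγ n (by have := hwle 1; exact this)
  set δn1 : ℝ := 1 / S' (S y n) 1 ^ 2 - 1 / S y (n + 1) ^ 2 with hδn1
  -- (c) per age: the drop of configuration n through the sandwich
  have hc : ∀ k ∈ Finset.Ico 1 K, L k * (S y (n + k) - S' (S y n) k)
      ≤ L k * (S y (n + k) - S' (S y (n + 1)) (k - 1)) + L k * S y (n + k) ^ 3 / 2 * δn1 := by
    intro k hkK
    obtain ⟨j, rfl⟩ : ∃ j, k = j + 1 := ⟨k - 1, by have := (Finset.mem_Ico.mp hkK).1; omega⟩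
    simp only [Nat.add_sub_cancel]
    have hsand := conf_sandwich hmono' hb' hB' hM' hlo' hS hS' huniq' hy hyγ n (hwle 1) j
    have hxM : S' (S y (n + 1)) j ≤ S y (n + (j + 1)) := by have := hkle j; rwa [show n + 1 + j = n + (j + 1) by ring] at this
    have hwM : S' (S y n) (j + 1) ≤ S y (n + (j + 1)) := hwle (j + 1)
    have habs := abs_sub_le_half_cube_mul (hkpos j) (hwpos (j + 1)) hxM hwM
    have hsplit : S y (n + (j + 1)) - S' (S y n) (j + 1)
        ≤ (S y (n + (j + 1)) - S' (S y (n + 1)) j) + S y (n + (j + 1)) ^ 3 / 2 * δn1 := by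
      by_cases hcase : S' (S y n) (j + 1) ≤ S' (S y (n + 1)) j
      · have hg0 : 0 ≤ S' (S y (n + 1)) j - S' (S y n) (j + 1) := by linarith
        have hl0 : 0 ≤ 1 / S' (S y n) (j + 1) ^ 2 - 1 / S' (S y (n + 1)) j ^ 2 :=
          sub_nonneg.mpr (one_div_le_one_div_of_le (pow_pos (hwpos _) 2) (pow_le_pow_left₀ (hwpos _).le hcase 2))
        rw [abs_of_nonneg hg0, abs_sub_comm, abs_of_nonneg hl0] at habs
        have := habs.trans (mul_le_mul_of_nonneg_left hsand (by have := hpos (n + (j + 1)); positivity))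
        linarith
      · have hcase := lt_of_not_ge hcase
        have : 0 ≤ S y (n + (j + 1)) ^ 3 / 2 * δn1 := by have := hpos (n + (j + 1)); positivity
        linarith
    have := mul_le_mul_of_nonneg_left hsplit (hL (j + 1))
    linarith
  -- (d) per age: the drop of configuration n+1 one row deeper, against the shifted drop: heating + damping defect
  have hd : ∀ k ∈ Finset.Ico 1 K, -((L k * S y (n + k) ^ 3 / 2 - L k * S y (n + 1 + k) ^ 3 / 2
        + L k * S y (n + 1 + k) ^ 3 / 2 * θ k)
          * (1 / S' (S y (n + 1)) (k - 1) ^ 2 - 1 / S y (n + k) ^ 2))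
      ≤ L k * (S y (n + 1 + k) - S' (S y (n + 1)) k) - L k * (S y (n + k) - S' (S y (n + 1)) (k - 1)) := by
    intro k hkK
    obtain ⟨j, rfl⟩ : ∃ j, k = j + 1 := ⟨k - 1, by have := (Finset.mem_Ico.mp hkK).1; omega⟩
    simp only [Nat.add_sub_cancel]
    rw [show n + 1 + (j + 1) = n + (j + 1) + 1 by ring]
    set δ : ℝ := 1 / S' (S y (n + 1)) j ^ 2 - 1 / S y (n + (j + 1)) ^ 2 with hδ
    set δ' : ℝ := 1 / S' (S y (n + 1)) (j + 1) ^ 2 - 1 / S y (n + (j + 1) + 1) ^ 2 with hδ'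
    have hx' := hpos (n + (j + 1) + 1)
    have hxx' : S y (n + (j + 1) + 1) ≤ S y (n + (j + 1)) := hanti (by omega)
    have hkj : S' (S y (n + 1)) j ≤ S y (n + (j + 1)) := by have := hkle j; rwa [show n + 1 + j = n + (j + 1) by ring] at this
    have hkj1 : S' (S y (n + 1)) (j + 1) ≤ S y (n + (j + 1) + 1) := by
      have := hkle (j + 1); rwa [show n + 1 + (j + 1) = n + (j + 1) + 1 by ring] at this
    have hδ0 : 0 ≤ δ := sub_nonneg.mpr (one_div_le_one_div_of_le (pow_pos (hkpos j) 2) (pow_le_pow_left₀ (hkpos j).le hkj 2))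
    -- the lowered point z below h_{n+1+k} at level gap δ
    obtain ⟨hz0, hzle, hzlev⟩ := inv_sqrt_facts hx' hδ0
    set z : ℝ := 1 / Real.sqrt (1 / S y (n + (j + 1) + 1) ^ 2 + δ) with hz
    -- heating
    have hheat := heating_le (y := S' (S y (n + 1)) j) (y' := z) hx' hxx' hδ0 (hkpos j) hz0 (by rw [hδ]; ring) hzlev
    -- damping defect: δ − δ′ ≤ θ δ (the hypothesis)
    have hθ := hdef j (Finset.mem_Ico.mp hkK).2
    rw [show n + 1 + j + 1 = n + (j + 1) + 1 by ring, show n + 1 + j = n + (j + 1) by ring] at hθ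
    have hθ' : δ - δ' ≤ θ (j + 1) * δ := by rw [hδ, hδ']; exact hθ
    have hθ0' : 0 ≤ θ (j + 1) := hθ0 (j + 1)
    -- second part: z − S′(h_{n+1})_{j+1} ≥ −(cube/2)·θ·δ
    have hsecond : -(S y (n + (j + 1) + 1) ^ 3 / 2 * (θ (j + 1) * δ)) ≤ z - S' (S y (n + 1)) (j + 1) := by
      by_cases hcase : S' (S y (n + 1)) (j + 1) ≤ z
      · have : 0 ≤ S y (n + (j + 1) + 1) ^ 3 / 2 * (θ (j + 1) * δ) := by have := mul_nonneg hθ0' hδ0; positivity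
        linarith
      · have hcase := lt_of_not_ge hcase
        have habs := abs_sub_le_half_cube_mul (hkpos (j + 1)) hz0 hkj1 hzle
        have hg0 : 0 ≤ S' (S y (n + 1)) (j + 1) - z := by linarith
        have hl : 1 / z ^ 2 - 1 / S' (S y (n + 1)) (j + 1) ^ 2 = δ - δ' := by rw [hzlev, hδ']; ring
        have hl0 : 0 ≤ 1 / z ^ 2 - 1 / S' (S y (n + 1)) (j + 1) ^ 2 :=
          sub_nonneg.mpr (one_div_le_one_div_of_le (pow_pos hz0 2) (pow_le_pow_left₀ hz0.le hcase.le 2))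
        rw [abs_of_nonneg hg0, abs_sub_comm, abs_of_nonneg hl0, hl] at habs
        have := habs.trans (mul_le_mul_of_nonneg_left hθ' (by positivity))
        linarith
    -- assemble the age
    have htot : -((S y (n + (j + 1)) ^ 3 / 2 - S y (n + (j + 1) + 1) ^ 3 / 2 + S y (n + (j + 1) + 1) ^ 3 / 2 * θ (j + 1)) * δ)
        ≤ (S y (n + (j + 1) + 1) - S' (S y (n + 1)) (j + 1)) - (S y (n + (j + 1)) - S' (S y (n + 1)) j) := by
      nlinarith [hheat, hsecond]
    have := mul_le_mul_of_nonneg_left htot (hL (j + 1))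
    have e1 : L (j + 1) * -((S y (n + (j + 1)) ^ 3 / 2 - S y (n + (j + 1) + 1) ^ 3 / 2 + S y (n + (j + 1) + 1) ^ 3 / 2 * θ (j + 1)) * δ)
        = -((L (j + 1) * S y (n + (j + 1)) ^ 3 / 2 - L (j + 1) * S y (n + (j + 1) + 1) ^ 3 / 2
          + L (j + 1) * S y (n + (j + 1) + 1) ^ 3 / 2 * θ (j + 1)) * δ) := by ring
    rw [e1] at this
    linarith
  -- sum the ages
  have hcsum := sum_le_sum hc
  have hdsum := sum_le_sum hd
  rw [sum_add_distrib] at hcsum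
  rw [sum_neg_distrib, sum_sub_distrib] at hdsum
  have hF : ∑ k ∈ Ico 1 K, L k * S y (n + k) ^ 3 / 2 * δn1 = (∑ k ∈ Ico 1 K, L k * S y (n + k) ^ 3 / 2) * δn1 := by rw [sum_mul]
  rw [hF] at hcsum
  have hF0 : 0 ≤ ∑ k ∈ Ico 1 K, L k * S y (n + k) ^ 3 / 2 := sum_nonneg fun k _ => by have := hL k; have := hpos (n + k); positivity
  have hFd : (∑ k ∈ Ico 1 K, L k * S y (n + k) ^ 3 / 2) * δn1 ≤ (∑ k ∈ Ico 1 K, L k * S y (n + k) ^ 3 / 2) * (B' (S' (S y (n + 1))) - B (S (S y (n + 1)))) :=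
    mul_le_mul_of_nonneg_left hdX hF0
  nlinarith [hcsum, hdsum, hFd, hXn, hXn1]

end Summit.QuantumFields.BalabanUV.Beta.EriceRemainderEnclosureHistoryAutonomyComparisonNonlinearRowDefect

end
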